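import Mathlib
import HarnessLib
import Summits.CriticalPhenomena.CardyFormulaZ2.Theses.CardySusyWard
import Summits.CriticalPhenomena.CardyFormulaZ2.Theorems.ParafermionPrecompact.Negative.ParafermionPrecompactFalseOfBulkNondegenerate
import Literature.Probability.LatticeModels.DartPhase
import Literature.Probability.LatticeModels.DirichletGreenFunction

/-!
# Line `kenyon-stream-second-relation` for the crux `CardySusyWard.ParafermionPrecompact`
(item stmt-CriticalPhenomena-11293) — CHECKED SKELETON (crux-plan, round 1)

See the line card `Lines/kenyon-stream-second-relation.md` for the prose. Short version.

**The crux as typed and the restatement gap.** By the landed negative lemma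
`Negative.parafermionPrecompact_iff_not_bulkNondegenerate` (p74235) the rev-5 text of
`ParafermionPrecompact` (clauses quantified over ALL `z z' : MedialVertex = Sym2 (Site 2)`) is
LITERALLY `¬ ParafermionBulkNondegenerate` (stretched-twin junk), i.e. false under the very
DCS Conjecture 8.7 whose tightness it means to state; the disprover, five refuters and all three
triagers ask the tenure planner to restate it as the edge-guarded
`C′ := ∀ D Λ, Negative.ParafermionPrecompactRepairedAt D Λ`. No set of TRUE stubs can conclude
the rev-5 decl. This skeleton therefore proves, sorry-free, the mathematical composition
`ParafermionPrecompactRepairedAt_of : stubs → C′` (C′ by the NAME of the landed definition; this is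
the audited/registered skeleton theorem, `ledger skeleton check … --crux-decl
…Negative.ParafermionPrecompactRepairedAt`, the same convention as the sibling line
`four-class-vertex-transfer`), the unfolded variant `ParafermionPrecompactGuarded_of` (rev-5 text +
the two guards), and `ParafermionPrecompact_of (hgap : RestatementGap) : stubs → ParafermionPrecompact`
reaching the ROUTE decl by name modulo the one non-mathematical hypothesis `RestatementGap : C′ →
ParafermionPrecompact` — deliberately NOT a registered stub (it is false modulo `H ∧ C′` today and
becomes unbundling the moment the planned `route edit --restate` lands; then delete `hgap`). All five
registered stubs are mathematics about `ℤ²` percolation and do not depend on the route text.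

**The line** (card + triage sharpenings): write the vertex passage-sum observable as
`κ Σ_q g_q` over the four corner (dart) classes (`stub_dartDictionary`); the dart field satisfies
the DCS/DC12 vertex relation EXACTLY (`stub_vertexRelation`, `c = i`, clockwise `NW,NE,SE,SW`)
and the SUM relation `F(NW)+F(SE) = F(NE)+F(SW)` up to a defect `sRes`; the algebraic heart
(the card's First lemma in quantitative form, VERIFIED numerically for the tree's conventions,
`algebra/pointwise.py`): the lattice Laplacian of every class component is an explicit zero-sum
stencil of the eight neighbouring `sRes` plus six neighbouring `vRes`, so Green's representation
on any finite `Λ ⊂ ℤ²` (PROVED in the tree, `green_representation`) bounds `|g_q(x₀)|` by a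
Green-GRADIENT-weighted sum of `|sRes|` plus the Poisson-kernel average of `|g_q|` on `∂Λ`
(`stub_greenMajorant`, deterministic, with a pair form for clause (ii)). The two probabilistic
inputs are then POSITIVE/MONOTONE or LOCAL: the surgery rate of the sum-relation defect relative
to the touch profile, exponent `> 4/3` (`stub_sumRelationDefect` — the lever, HARDEST, Zhou
Prop. 4.3 (96) re-proved for the tree's plain observable), and the harmonic-measure /
Green-gradient averaged boundary-touch law at scale `δ^{1/3}` (`stub_touchProfileLaws` — the
sharp boundary one-arm input in the only form the line consumes). `Λ` is the set of `6δ`-deep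
sites, whose outer boundary is the lattice layer where `|g_q| ≤ touch probability` is free.

Audit target: `ParafermionPrecompactRepairedAt_of : Sig.stub_dartDictionary → Sig.stub_vertexRelation →
Sig.stub_greenMajorant → Sig.stub_sumRelationDefect → Sig.stub_touchProfileLaws →
∀ D Λ, Negative.ParafermionPrecompactRepairedAt D Λ` (hypothesis heads = stub names); `sorry` only in
the five `theorem stub_* : Sig.stub_*`.
-/

noncomputable section

namespace Summit.CriticalPhenomena.CardyFormulaZ2.Cruxes.ParafermionPrecompact.KenyonStreamSecondRelation

open scoped BigOperators Topology Classical
open Filter Set MeasureTheory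
open Literature.Probability.LatticeModels
open Literature.Probability.RandomPlanarGeometry (DobrushinDomain)
open Literature.Probability.Percolation (BondConfig bondPercolation half)
open Summit.CriticalPhenomena.CardyFormulaZ2.Theorems.ParafermionPrecompact.Negative
  (F IsFamily ClauseBoundEdges ClauseEquicontEdges ParafermionPrecompactRepairedAt
    exists_eq_mk_add_single)
open Summit.CriticalPhenomena.CardyFormulaZ2.Theses.CardySusyWard (ParafermionPrecompact)

/-! ### Lattice vocabulary: classes, corners, the two local residuals -/

/-- Unit vector `eᵢ` of `ℤ²`. -/
def ex (i : Fin 2) : Site 2 := Pi.single i 1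

/-- The four corner classes `c_q = f - v ∈ {0, -e₀, -e₀-e₁, -e₁}` of a corner `(v, f)`
(`IsCorner v f`), in the order of the stream-function weights `u = (1, i, -1, -i)` of the card. -/
def classOffset : Fin 4 → Site 2 := ![0, -ex 0, -ex 0 - ex 1, -ex 1]

/-- The class-`q` component of a function on corners: `g_q(v) = Φ(v, v + c_q)`. -/
def classComp (Φ : Site 2 × Site 2 → ℂ) (q : Fin 4) (v : Site 2) : ℂ := Φ (v, v + classOffset q)

/-- The pivot (site) of the class-`q` corner incident to the medial vertex `s(x, x + eᵢ)`:
horizontal edge (`i = 0`): classes `0, 3` pivot at `x`, classes `1, 2` at `x + e₀`; vertical edge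
(`i = 1`): classes `0, 1` at `x`, classes `2, 3` at `x + e₁`. (Each medial vertex carries exactly
one corner of each class: `(x,x), (x+e₀,x), (x+e₀,x-e₁), (x,x-e₁)` resp.
`(x,x), (x,x-e₀), (x+e₁,x-e₀), (x+e₁,x)`.) -/
def pivotOf (x : Site 2) (i : Fin 2) (q : Fin 4) : Site 2 :=
  if i = 0 then ![x, x + ex 0, x + ex 0, x] q else ![x, x, x + ex 1, x + ex 1] q

/-- The four corners at the medial vertex `s(x, x + eᵢ)` listed CLOCKWISE `NW, NE, SE, SW`
(verbatim the barrier file's `Literature.Barriers.CriticalPhenomena.medialCornersAt`, copied to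
keep the import cone of the eventual Theorems file clean). -/
def cornersAt (x : Site 2) : Fin 2 → Fin 4 → Site 2 × Site 2
  | 0 => ![(x, x), (x + ex 0, x), (x + ex 0, x - ex 1), (x, x - ex 1)]
  | 1 => ![(x + ex 1, x - ex 0), (x + ex 1, x), (x, x), (x, x - ex 0)]

/-- The genuine medial vertex (lattice edge) `s(y, y + eᵢ)` indexed by `p = (y, i)`; no `Sym2`
junk can occur in statements quantified over `p : Site 2 × Fin 2`. -/
def mv (p : Site 2 × Fin 2) : MedialVertex := s(p.1, p.1 + ex p.2)

/-- VERTEX residual (DCS Prop. 8.6 / Duminil-Copin 2012 Prop. 4 with the tree's certified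
coefficient `c = i`, clockwise `NW, NE, SE, SW`): `Φ(NW) - Φ(SE) - i (Φ(NE) - Φ(SW))`. -/
def vRes (Φ : Site 2 × Site 2 → ℂ) (p : Site 2 × Fin 2) : ℂ :=
  Φ (cornersAt p.1 p.2 0) - Φ (cornersAt p.1 p.2 2) -
    Complex.I * (Φ (cornersAt p.1 p.2 1) - Φ (cornersAt p.1 p.2 3))

/-- SUM residual (the card's "second relation" `E(A)+E(C) = E(B)+E(D)`, `A, C` the two darts
pointing to the medial vertex): the alternating clockwise sum `Φ(NW) - Φ(NE) + Φ(SE) - Φ(SW)`. -/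
def sRes (Φ : Site 2 × Site 2 → ℂ) (p : Site 2 × Fin 2) : ℂ :=
  Φ (cornersAt p.1 p.2 0) - Φ (cornersAt p.1 p.2 1) + Φ (cornersAt p.1 p.2 2) - Φ (cornersAt p.1 p.2 3)

/-- The two faces (lower-left corners) adjacent to the edge `p = (y, i)`: `y` (above / east) … -/
def faceA (p : Site 2 × Fin 2) : Site 2 := p.1

/-- … and `y - e₁` (below) for a horizontal edge, `y - e₀` (west) for a vertical one. -/
def faceB (p : Site 2 × Fin 2) : Site 2 := if p.2 = 0 then p.1 - ex 1 else p.1 - ex 0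

/-- The 18 edges `(y, j)` with `‖y - x‖_∞ ≤ 1` — the support of the Laplacian stencil at `x`. -/
def window (x : Site 2) : Finset (Site 2 × Fin 2) :=
  (Finset.univ : Finset (Fin 3 × Fin 3 × Fin 2)).image
    fun t => (x + ![((t.1 : ℕ) : ℤ) - 1, ((t.2.1 : ℕ) : ℤ) - 1], t.2.2)

/-- The edges within sup-distance `1` of the finite site set `Λ`. -/
def nearEdges (Λ : Finset (Site 2)) : Finset (Site 2 × Fin 2) := Λ.biUnion window

/-- GREEN-GRADIENT WEIGHT of the edge `p = (y,i)` seen from `x₀ ∈ Λ`, class `q`: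
`|G_Λ(x₀,y) - G_Λ(x₀,y+eᵢ)| + |G_Λ(x₀, f_p - c_q) - G_Λ(x₀, f'_p - c_q)|` — the moduli of the two
`G`-differences that multiply `sRes_p` after summation by parts (primal edge and the dual edge
shifted by the class; stencil coefficients have modulus `1/√2 ≤ 1`). `dirichletGreen Λ x₀ ·`
vanishes off `Λ`, so only edges near `Λ` carry weight. -/
def greenWeight (Λ : Finset (Site 2)) (x₀ : Site 2) (q : Fin 4) (p : Site 2 × Fin 2) : ℝ :=
  |dirichletGreen Λ x₀ p.1 - dirichletGreen Λ x₀ (p.1 + ex p.2)| +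
    |dirichletGreen Λ x₀ (faceA p - classOffset q) - dirichletGreen Λ x₀ (faceB p - classOffset q)|

/-- The same weight for the DIFFERENCE `y ↦ G_Λ(x₀,y) - G_Λ(x₁,y)` (clause (ii)). -/
def greenWeight₂ (Λ : Finset (Site 2)) (x₀ x₁ : Site 2) (q : Fin 4) (p : Site 2 × Fin 2) : ℝ :=
  |(dirichletGreen Λ x₀ p.1 - dirichletGreen Λ x₁ p.1) -
      (dirichletGreen Λ x₀ (p.1 + ex p.2) - dirichletGreen Λ x₁ (p.1 + ex p.2))| +
    |(dirichletGreen Λ x₀ (faceA p - classOffset q) - dirichletGreen Λ x₁ (faceA p - classOffset q)) -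
      (dirichletGreen Λ x₀ (faceB p - classOffset q) - dirichletGreen Λ x₁ (faceB p - classOffset q))|

/-! ### Percolation vocabulary: the dart field, touch probabilities, the defect profile -/

/-- The `q = 1`, spin-`1/3` DART FIELD of the discrete Dobrushin datum `E` at its own mesh:
`Φ_E(v,f) = bondDartObservable E E.δ (1/3) (v,f)` (the tree's edge observable, `DartPhase.lean`). -/
def dartField (E : DiscreteDobrushin) : Site 2 × Site 2 → ℂ := fun c => bondDartObservable E E.δ (1 / 3) c

/-- TOUCH PROBABILITY: the `P_{1/2}`-probability that the medial exploration path of `E` visits a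
medial vertex within distance `r` of the point `z` (a positive, monotone, phase-free quantity). -/
def touchProb (E : DiscreteDobrushin) (z : ℂ) (r : ℝ) : ℝ :=
  (bondPercolation (zdGraph 2) half).real
    {ω | ∃ e ∈ medialExploration E ω, dist (medialPoint E.δ e) z ≤ r}

/-- The DEPTH of the edge `p` in `E`: distance from its midpoint to the complement of the domain,
floored at one mesh (so that the boundary layer has depth `δ`). -/
def edgeDepth (E : DiscreteDobrushin) (p : Site 2 × Fin 2) : ℝ :=
  max (Metric.infDist (medialPoint E.δ (mv p)) E.Ωᶜ) E.δ

/-- The DEFECT PROFILE with exponent `pz`: `(δ / depth)^{pz} × touchProb (midpoint, depth / 2)` —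
the shape a `pz`-arm surgery bound takes RELATIVE to the probability that the interface comes
within half the depth (in the boundary layer it is the bare touch probability). -/
def defectProfile (E : DiscreteDobrushin) (pz : ℝ) (p : Site 2 × Fin 2) : ℝ :=
  (E.δ / edgeDepth E p) ^ pz * touchProb E (medialPoint E.δ (mv p)) (edgeDepth E p / 2)

/-- The `6δ`-DEEP sites of the Dobrushin domain `D` at mesh `δ` (as a set). -/
def deepSet (D : DobrushinDomain) (δ : ℝ) : Set (Site 2) :=
  {x | Metric.closedBall (meshPoint δ x) (6 * δ) ⊆ D.carrier}

/-- The `6δ`-deep sites as a `Finset` (finite for `δ > 0` since `D` is bounded; junk `∅` else).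
This is the `Λ` on which the line runs Green's representation: its outer boundary is the
lattice layer within `7δ` of `∂D`, where `|g_q| ≤` touch probability is free. -/
def deepSites (D : DobrushinDomain) (δ : ℝ) : Finset (Site 2) :=
  if h : (deepSet D δ).Finite then h.toFinset else ∅

/-- `κ = (2 cos (π/12))⁻¹`: at an interior passage the incoming and outgoing dart phases
`e^{-iW_in/3} + e^{-iW_out/3} = 2 cos(π/12) e^{-i·windingAt/3}` (`W_out = W_in ± π/2`). -/
def kappa : ℝ := (2 * Real.cos (Real.pi / 12))⁻¹

/-! ### The five registered stubs

Each stub's statement is the `Prop` `Sig.stub_<name>` (its SIGNATURE) and the registered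
obligation is `theorem stub_<name> : Sig.stub_<name> := by sorry`; the compositions take the
signatures as hypotheses BY NAME. -/

/-- STUB 1 — DART DICTIONARY (size M; provable now; shared first stub with the four-class /
vertex-sum cards, cf. triage). (a) On compacts, eventually in `δ`, the crux's vertex passage-sum
observable at a genuine medial vertex `s(x, x+eᵢ)` is `κ` times the sum of the four class
components of the dart field at their pivots: every passage through an interior medial vertex
consists of an incoming and an outgoing dart turning by `±π/2` (`IsMedialTurn`), and
`windingAt` is their mid-winding (`MedialWinding.lean`); "eventually/on `K`" only removes the two
`A`–`B` edges `e_a, e_b` (single dart), whose midpoints tend to the marks `{a,b} ⊂ ∂D`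
(family field 5) while `K ⊂ D` is compact. (b) A class component is bounded by the probability
that the exploration visits the `δ`-ball at its pivot (`|E ∑ unimodular| ≤ P(dart used)`,
`norm_dartPhaseSum_le_one`; the dart's source medial vertex is at distance `δ/2` from the pivot;
positive mesh required: for `E.δ < 0` the ball would be empty).
Why it might fail: only by convention slips (position of `κ`, which endpoint is "source"):
repair by re-indexing `pivotOf`. -/
def Sig.stub_dartDictionary : Prop :=
  (∀ (D : DobrushinDomain) (Λ : ℝ → DiscreteDobrushin), IsFamily D Λ →
      ∀ K : Set ℂ, IsCompact K → K ⊆ D.carrier →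
        ∀ᶠ δ in 𝓝[>] (0:ℝ), ∀ (x : Site 2) (i : Fin 2), medialPoint δ (mv (x, i)) ∈ K →
          F Λ δ (mv (x, i)) =
            (kappa : ℂ) * ∑ q : Fin 4, classComp (dartField (Λ δ)) q (pivotOf x i q)) ∧
    ∀ (E : DiscreteDobrushin), 0 < E.δ → ∀ (q : Fin 4) (w : Site 2),
      ‖classComp (dartField E) q w‖ ≤ touchProb E (meshPoint E.δ w) E.δ

/-- STUB 2 — VERTEX RELATION, EXACT (size M–L; provable now; = DCS 2012 Prop. 8.6 /
Duminil-Copin 2012 Prop. 4 at `q = 1` for the tree's `bondDartObservable`, coefficient `c = +i`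
in the clockwise indexing `NW, NE, SE, SW` as certified by exact enumeration for the tree's
winding conventions (triage T2 of crux stmt-11387; r1-3 of this crux: `E₀ - iE₁ - E₂ + iE₃ = 0`
in class labels)). For admissible data `E` the dart field satisfies the vertex relation at every
medial vertex whose `2δ`-neighbourhood lies inside the domain: there the edge is not frozen by the
boundary conditions and its two faces are both inner faces of `Ω_δ` (or, in a non-principal
component of `Ω ∩ δℤ²`, all four darts are unused and the relation is `0 = 0`), so the
measure-preserving involution `ω ↦ ω Δ {edge}` of the printed proof applies. Why it might fail:
the sign of `c` (conjugation convention) — then `c = -i` and every later stub is unchanged up to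
conjugating the stencil; a `2δ`-deep edge of a slit-like domain whose faces straddle the slit
(excluded: the closed ball lies in the open domain). -/
def Sig.stub_vertexRelation : Prop :=
  ∀ (E : DiscreteDobrushin), E.IsZdAdmissible → ∀ p : Site 2 × Fin 2,
    Metric.closedBall (medialPoint E.δ (mv p)) (2 * E.δ) ⊆ E.Ω → vRes (dartField E) p = 0

/-- STUB 3 — GREEN MAJORANT WITH GRADIENT WEIGHTS (size L; deterministic discrete potential
theory + the Kenyon stencil; provable now). For ANY finite `Λ ⊂ ℤ²` and ANY function `Φ` on
corners whose vertex residual vanishes on the edges within sup-distance `1` of `Λ`, every class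
component satisfies, at every `x₀ ∈ Λ`,
`|g_q(x₀)| ≤ Σ_p greenWeight Λ x₀ q p · |sRes Φ p| + Σ_{w ∈ ∂Λ} H_Λ(x₀,w) |g_q(w)|`
and the pair form with `greenWeight₂` / `|H_Λ(x₀,·) - H_Λ(x₁,·)|`. Proof route: Green's
representation `g(x₀) = Σ_y G_Λ(x₀,y)(-Δg)(y) + Σ_w H_Λ(x₀,w) g(w)` (tree: `green_representation`,
apply to `Re g`, `Im g`), then the POINTWISE STENCIL IDENTITY (the card's First lemma made
quantitative; verified to `1e-14` on random fields, `algebra/pointwise.py`):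
`Δg_q(y₀) = Σ_{8 edges p} sRes_p·[α_{q,i}(𝟙_{y=y₀} - 𝟙_{y+eᵢ=y₀}) + β_{q,i}(𝟙_{f_p-c_q=y₀} - 𝟙_{f'_p-c_q=y₀})] + Σ_{6 edges} γ·vRes_p`
with `α, β ∈ (±1±i)/2`, i.e. `Δψ_V = div κ`, `Δψ_F = div⋆ κ` for the DST stream function, `κ_p ∝ sRes_p`
(Kenyon–Duffin CR on the rhombus at `p`); resumming against `G_Λ(x₀,·)` (zero off `Λ`) gives the
gradient weights. With `sRes ≡ 0` it is the card's `ClassHarmonicOfBothRelations` (triage: true).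
Why it might fail: it cannot (finite identity + a proved representation); a slip in `faceA/faceB`
or `classOffset` would only permute the weight's arguments. -/
def Sig.stub_greenMajorant : Prop :=
  ∀ (Λ : Finset (Site 2)) (Φ : Site 2 × Site 2 → ℂ), (∀ p ∈ nearEdges Λ, vRes Φ p = 0) →
    ∀ (q : Fin 4) (x₀ : Site 2), x₀ ∈ Λ →
      ‖classComp Φ q x₀‖ ≤
          (∑ p ∈ nearEdges Λ, greenWeight Λ x₀ q p * ‖sRes Φ p‖) +
            ∑ w ∈ outerBoundary (zdGraph 2) Λ,
              Literature.Probability.LatticeModels.poissonKernel Λ x₀ w * ‖classComp Φ q w‖ ∧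
        ∀ x₁ ∈ Λ,
          ‖classComp Φ q x₀ - classComp Φ q x₁‖ ≤
            (∑ p ∈ nearEdges Λ, greenWeight₂ Λ x₀ x₁ q p * ‖sRes Φ p‖) +
              ∑ w ∈ outerBoundary (zdGraph 2) Λ,
                |Literature.Probability.LatticeModels.poissonKernel Λ x₀ w -
                    Literature.Probability.LatticeModels.poissonKernel Λ x₁ w| * ‖classComp Φ q w‖

/-- STUB 4 — SUM-RELATION DEFECT RATE, the lever (HARDEST; size XL; Zhou arXiv:2409.03235
§3–4, Prop. 4.3 (96), re-proved for the tree's PLAIN dart observable and in RELATIVE form). There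
are `C` and an exponent `pz > 4/3` such that for every admissible datum and every edge `p`,
`|sRes Φ_E (p)| ≤ C · (δ/depth)^{pz} · P(γ comes within depth/2 of p)`. Mechanism: the
reflection-through-the-medial-vertex ∘ duality symmetry of the `n = 1` loop ensemble, applied as
a surgery on the loop attached at `p` and the exploration prefix, re-pairs "possibility `j`, two
visits" with "possibility `j+1`, one visit" with windings shifted by `±π/2`; it fails only on a
polychromatic 5-arm-type event around `p` out to the depth scale (exponent `2 > 4/3`, KSZ on
`ℤ²`), whence the profile by quasi-multiplicativity. RELATIVE FORM (× the touch probability of the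
depth/2-ball) rather than Zhou's printed absolute `O((δ/d)²)`: this is what quasi-multiplicativity
predicts (the defect event forces `γ` into that ball) and it is NECESSARY for the line — with an
absolute bound the layers at lattice depth `D = 2 … δ^{-1}` would contribute
`Σ_D D^{-pz}·O(1) = O(1) ≫ δ^{1/3}` to the Green sum of STUB 5 (Zhou instead reflects across the
flat pieces of his Condition C). In the boundary layer (`depth = δ`) the statement is the trivial
`|sRes| ≤ 4 P(p ∈ γ)` (`C ≥ 4`). Why it might fail: for the PLAIN field
the defect is `2(F_i(A)+F_i(C)) + O((δ/d)²)` with Zhou's staggered companion `F_i` (triage r1-2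
(F1)); its leading `ū` zero-mode satisfies the sum relation exactly (r1-3 E1) and the measured
signed defect is `≤ 7·10⁻⁴ |F|` in the bulk (MC-EVIDENCE-ideator2), but its RATE is unknown
(`p ∈ [0.7, 2]` from exact `n = 3` / MC): if only `pz ≤ 4/3` holds for the plain field, reshape
to Zhou's isotropised `F̃` plus a companion stub `Σ_{4 darts}(F - F̃) = O((δ/d)²)` ((98)–(100)),
which the vertex sum of STUB 1 tolerates. The surgery itself (bijectivity, `P(𝓔_v)`) is 30 pp. of
uncertified case analysis. -/
def Sig.stub_sumRelationDefect : Prop :=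
  ∃ C pz : ℝ, 4 / 3 < pz ∧ 0 ≤ C ∧ ∀ (E : DiscreteDobrushin), E.IsZdAdmissible →
    ∀ p : Site 2 × Fin 2, ‖sRes (dartField E) p‖ ≤ C * defectProfile E pz p

/-- STUB 5 — TOUCH-PROFILE LAWS (size XL; the sharp boundary one-arm input, in the only —
averaged — form the line consumes; = the card's `BoundaryTouchHM` + its Green companion, with
the triage's scope warning). For a discretisation family of `D`, a compact `K ⊂ D` and any
exponent `pz > 4/3`: eventually in `δ`, uniformly over `6δ`-deep sites `x₀` over `K`,
(i) `Σ_p greenWeight Λ_δ x₀ q p · defectProfile_δ(p) ≤ C δ^{1/3}` and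
`Σ_{w ∈ ∂Λ_δ} H_{Λ_δ}(x₀,w) · touchProb(δw, δ) ≤ C δ^{1/3}` (`Λ_δ` = deep sites; `∂Λ_δ` lies within
`7δ` of `∂D`, so the second sum is the harmonic measure, seen from `x₀`, of the `δ`-sausage of the
BOUNDARY TOUCHING SET — exponent `1/3` = harmonic-measure codimension of that set = boundary
one-arm exponent; the first adds the interior Green-gradient bookkeeping: bulk `δ^{pz-1}`, layer
`δ^{1/3} Σ_D D^{1/3-pz}`), and (ii) the same sums for nearby `x₀, x₁` with DIFFERENCE weights are
`≤ ε δ^{1/3}` once `|δx₀ - δx₁| < η` ((ii) is (i) + discrete Harnack). Inputs: sharp half-plane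
one-arm UPPER bound on bond-`ℤ²` (Ikhlef–Ponsaing 2012 Props. 4.7–4.9 for the DIAGONAL strip,
slope transport = crux stmt-5662 `HalfPlaneOneArmThird`, cards ip12-boundary-scale /
track-rotation-to-rs), RSW/quasi-multiplicativity for the scale profile, Beurling-type
harmonic-measure estimates on `Ω_δ` (tree: `LatticeHarmonicMeasure`, `WeakBeurlingHoleFree`).
Why it might fail: the crux ranges over ALL Jordan domains; for non-smooth `∂D` the HM ×
one-arm pairing is only heuristically balanced (corners of any angle are fine: `∫ r^{4π/3θ-4/3}`),
and the sharp `1/3` on `ℤ²` is not reachable by RSW alone (necessity remark of triage §0: any proof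
of C′ contains it). -/
def Sig.stub_touchProfileLaws : Prop :=
  ∀ (D : DobrushinDomain) (Λ : ℝ → DiscreteDobrushin), IsFamily D Λ →
    ∀ K : Set ℂ, IsCompact K → K ⊆ D.carrier → ∀ pz : ℝ, 4 / 3 < pz →
      (∃ C : ℝ, ∀ᶠ δ in 𝓝[>] (0:ℝ), ∀ (q : Fin 4), ∀ x₀ ∈ deepSites D δ, meshPoint δ x₀ ∈ K →
          (∑ p ∈ nearEdges (deepSites D δ),
              greenWeight (deepSites D δ) x₀ q p * defectProfile (Λ δ) pz p) ≤ C * δ ^ ((1:ℝ) / 3) ∧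
            (∑ w ∈ outerBoundary (zdGraph 2) (deepSites D δ),
              Literature.Probability.LatticeModels.poissonKernel (deepSites D δ) x₀ w *
                touchProb (Λ δ) (meshPoint δ w) δ) ≤ C * δ ^ ((1:ℝ) / 3)) ∧
        ∀ ε > (0:ℝ), ∃ η > (0:ℝ), ∀ᶠ δ in 𝓝[>] (0:ℝ), ∀ (q : Fin 4),
          ∀ x₀ ∈ deepSites D δ, ∀ x₁ ∈ deepSites D δ, meshPoint δ x₀ ∈ K → meshPoint δ x₁ ∈ K →
            dist (meshPoint δ x₀) (meshPoint δ x₁) < η →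
              (∑ p ∈ nearEdges (deepSites D δ),
                  greenWeight₂ (deepSites D δ) x₀ x₁ q p * defectProfile (Λ δ) pz p) ≤
                  ε * δ ^ ((1:ℝ) / 3) ∧
                (∑ w ∈ outerBoundary (zdGraph 2) (deepSites D δ),
                  |Literature.Probability.LatticeModels.poissonKernel (deepSites D δ) x₀ w -
                      Literature.Probability.LatticeModels.poissonKernel (deepSites D δ) x₁ w| *
                    touchProb (Λ δ) (meshPoint δ w) δ) ≤ ε * δ ^ ((1:ℝ) / 3)

/-! ### The restatement gap (NOT a stub) and the guarded text of the crux

No registered obligation here: see the module docstring. -/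

/-- THE RESTATEMENT GAP (a plain `Prop`, deliberately NOT a registered stub — registering it would
put a believed-false obligation on the item). The repaired crux
`C′ = ∀ D Λ, Negative.ParafermionPrecompactRepairedAt D Λ` (edge guards; the disprover's, the five
refuters' and the triage panel's requested restatement of item 11293) implies the route decl. TODAY
this is equivalent to `C′ → ¬ParafermionBulkNondegenerate`
(`Negative.parafermionPrecompact_iff_not_bulkNondegenerate`), false modulo `H ∧ C′` exactly like
the crux text itself (HELD, negative lemma p74235). The moment the tenure planner's
`route edit --restate ParafermionPrecompact` lands (same decl name, text `C′` or its unfolding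
`ParafermionPrecompactGuarded` below) it is `fun h => h` up to unbundling, and
`ParafermionPrecompact_of` below loses its first hypothesis. -/
def RestatementGap : Prop :=
  (∀ (D : DobrushinDomain) (Λ : ℝ → DiscreteDobrushin), ParafermionPrecompactRepairedAt D Λ) →
    ParafermionPrecompact

/-- THE GUARDED TEXT: the rev-5 statement of `ParafermionPrecompact` VERBATIM with the two
genuineness guards `z ∈ (zdGraph 2).edgeSet →` / `z' ∈ (zdGraph 2).edgeSet →` inserted (= the
refuters' `Repaired.lean`, = `∀ D Λ, Negative.ParafermionPrecompactRepairedAt D Λ` unbundled,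
`guarded_of_repairedAt`). If the restatement lands in this unfolded form,
`theorem ParafermionPrecompact_of := ParafermionPrecompactGuarded_of` retargets by `rfl`. -/
def ParafermionPrecompactGuarded : Prop :=
  ∀ (D : Literature.Probability.RandomPlanarGeometry.DobrushinDomain) (Λ : ℝ → Literature.Probability.LatticeModels.DiscreteDobrushin), (∀ δ, (Λ δ).Ω = D.carrier) → (∀ δ, (Λ δ).δ = δ) → Filter.Tendsto (fun δ : ℝ => Metric.hausdorffEDist (Λ δ).arcA (D.arc 0)) (nhdsWithin (0:ℝ) (Set.Ioi 0)) (nhds 0) → Filter.Tendsto (fun δ : ℝ => Metric.hausdorffEDist (Λ δ).arcB (D.arc 1)) (nhdsWithin (0:ℝ) (Set.Ioi 0)) (nhds 0) → Filter.Tendsto (fun δ : ℝ => Metric.hausdorffEDist (Literature.Probability.LatticeModels.medialPoint δ '' (Λ δ).zdABEdges) {D.pt 0, D.pt 1}) (nhdsWithin (0:ℝ) (Set.Ioi 0)) (nhds 0) → (∀ᶠ δ in nhdsWithin (0:ℝ) (Set.Ioi 0), (Λ δ).IsZdAdmissible) → ∀ K : Set ℂ, IsCompact K → K ⊆ D.carrier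 → (∃ C : ℝ, ∀ᶠ δ in nhdsWithin (0:ℝ) (Set.Ioi 0), ∀ z : Literature.Probability.LatticeModels.MedialVertex, z ∈ (Literature.Probability.LatticeModels.zdGraph 2).edgeSet → Literature.Probability.LatticeModels.medialPoint δ z ∈ K → ‖(∫ ω, Literature.Probability.LatticeModels.passageSum (Literature.Probability.LatticeModels.medialExploration (Λ δ) ω) δ (1 / 3) z ∂(Literature.Probability.Percolation.bondPercolation (Literature.Probability.LatticeModels.zdGraph 2) Literature.Probability.Percolation.half))‖ ≤ C * δ ^ ((1:ℝ) / 3)) ∧ (∀ ε > (0:ℝ), ∃ η > (0:ℝ), ∀ᶠ δ in nhdsWithin (0:ℝ) (Set.Ioi 0), ∀ z z' : Literature.Probability.LatticeModels.MedialVertex, z ∈ (Literature.Probability.LatticeModels.zdGraph 2).edgeSet → z' ∈ (Literature.Probability.LatticeModels.zdGraph 2).edgeSet → Literature.Probability.LatticeModels.medialPoint δ z ∈ K → Literature.Probability.LatticeModels.medialPoint δ z' ∈ K → dist (Literature.Probability.LatticeModels.medialPoint δ z) (Literature.Probability.LatticeModels.medialPoint δ z') < η → ‖(∫ ω, Literature.Probability.LatticeModels.passageSum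 (Literature.Probability.LatticeModels.medialExploration (Λ δ) ω) δ (1 / 3) z ∂(Literature.Probability.Percolation.bondPercolation (Literature.Probability.LatticeModels.zdGraph 2) Literature.Probability.Percolation.half)) - (∫ ω, Literature.Probability.LatticeModels.passageSum (Literature.Probability.LatticeModels.medialExploration (Λ δ) ω) δ (1 / 3) z' ∂(Literature.Probability.Percolation.bondPercolation (Literature.Probability.LatticeModels.zdGraph 2) Literature.Probability.Percolation.half))‖ ≤ ε * δ ^ ((1:ℝ) / 3))

/-- The bundled repaired crux gives the guarded text (pure unbundling). -/
theorem guarded_of_repairedAt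
    (h : ∀ (D : DobrushinDomain) (Λ : ℝ → DiscreteDobrushin), ParafermionPrecompactRepairedAt D Λ) :
    ParafermionPrecompactGuarded :=
  fun D Λ h1 h2 h3 h4 h5 h6 K hK hKD => h D Λ ⟨h1, h2, h3, h4, h5, h6⟩ K hK hKD

/-- Registered stub 1 (dart dictionary). -/
theorem stub_dartDictionary : Sig.stub_dartDictionary := by
  sorry

/-- Registered stub 2 (exact vertex relation). -/
theorem stub_vertexRelation : Sig.stub_vertexRelation := by
  sorry

/-- Registered stub 3 (Green majorant with gradient weights — the Kenyon stencil). -/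
theorem stub_greenMajorant : Sig.stub_greenMajorant := by
  sorry

/-- Registered stub 4 (sum-relation defect rate — the lever, HARDEST). -/
theorem stub_sumRelationDefect : Sig.stub_sumRelationDefect := by
  sorry

/-- Registered stub 5 (touch-profile laws — boundary one-arm input, averaged form). -/
theorem stub_touchProfileLaws : Sig.stub_touchProfileLaws := by
  sorry


/-! ### Glue (elementary, sorry-free) -/

/-- The deep set is finite for a positive mesh (the domain is bounded). -/
theorem deepSet_finite (D : DobrushinDomain) {δ : ℝ} (hδ : 0 < δ) : (deepSet D δ).Finite :=
  (meshVertices_finite D.isBounded hδ).subset fun x hx =>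
    show meshPoint δ x ∈ D.carrier from hx (Metric.mem_closedBall_self (by positivity))

/-- Membership in `deepSites` for a positive mesh. -/
theorem mem_deepSites (D : DobrushinDomain) {δ : ℝ} (hδ : 0 < δ) {x : Site 2} :
    x ∈ deepSites D δ ↔ Metric.closedBall (meshPoint δ x) (6 * δ) ⊆ D.carrier := by
  rw [deepSites, dif_pos (deepSet_finite D hδ), Set.Finite.mem_toFinset]
  rfl

/-- An edge of the window of `x` has its base site within sup-distance `1` of `x`. -/
theorem abs_le_of_mem_window {x : Site 2} {p : Site 2 × Fin 2} (hp : p ∈ window x) :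
    |p.1 0 - x 0| ≤ 1 ∧ |p.1 1 - x 1| ≤ 1 := by
  simp only [window, Finset.mem_image, Finset.mem_univ, true_and] at hp
  obtain ⟨⟨a, b, j⟩, rfl⟩ := hp
  have ha := a.isLt
  have hb := b.isLt
  simp only [Pi.add_apply, Matrix.cons_val_zero, Matrix.cons_val_one]
  constructor <;> rw [abs_le] <;> constructor <;> omega

/-- The midpoint of a window edge is within `4δ` of the window's centre. -/
theorem dist_medialPoint_mv_le {δ : ℝ} (hδ : 0 ≤ δ) {x : Site 2} {p : Site 2 × Fin 2}
    (h0 : |p.1 0 - x 0| ≤ 1) (h1 : |p.1 1 - x 1| ≤ 1) :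
    dist (medialPoint δ (mv p)) (meshPoint δ x) ≤ 4 * δ := by
  obtain ⟨y, j⟩ := p
  have h0' : |((y 0 : ℤ) : ℝ) - x 0| ≤ 1 := by exact_mod_cast h0
  have h1' : |((y 1 : ℤ) : ℝ) - x 1| ≤ 1 := by exact_mod_cast h1
  obtain ⟨h0a, h0b⟩ := abs_le.1 h0'
  obtain ⟨h1a, h1b⟩ := abs_le.1 h1'
  rw [Complex.dist_eq]
  refine (Complex.norm_le_abs_re_add_abs_im _).trans ?_
  have hre : |(medialPoint δ (mv (y, j)) - meshPoint δ x).re| ≤ 2 * δ := by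
    fin_cases j <;>
      simp [mv, ex, medialPoint_mk, meshPoint_re, Pi.add_apply] <;>
      rw [abs_le] <;> constructor <;> nlinarith
  have him : |(medialPoint δ (mv (y, j)) - meshPoint δ x).im| ≤ 2 * δ := by
    fin_cases j <;>
      simp [mv, ex, medialPoint_mk, meshPoint_im, Pi.add_apply] <;>
      rw [abs_le] <;> constructor <;> nlinarith
  linarith

/-- The pivot of a class at a medial vertex is one of the two endpoints of the edge. -/
theorem pivotOf_eq_or (x : Site 2) (i : Fin 2) (q : Fin 4) :
    pivotOf x i q = x ∨ pivotOf x i q = x + ex i := by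
  fin_cases i <;> fin_cases q <;> simp [pivotOf]

/-- The pivot is within one mesh of the midpoint of the edge. -/
theorem dist_pivotOf_le {δ : ℝ} (hδ : 0 ≤ δ) (x : Site 2) (i : Fin 2) (q : Fin 4) :
    dist (meshPoint δ (pivotOf x i q)) (medialPoint δ (mv (x, i))) ≤ δ := by
  rw [Complex.dist_eq]
  refine (Complex.norm_le_abs_re_add_abs_im _).trans ?_
  have key : ∀ a b : ℝ, |a| ≤ δ / 2 → |b| ≤ δ / 2 → |a| + |b| ≤ δ := fun a b ha hb => by linarith
  apply key
  · rcases pivotOf_eq_or x i q with h | h <;> rw [h] <;> fin_cases i <;>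
      simp [mv, ex, medialPoint_mk, meshPoint_re, Pi.add_apply] <;>
      first
        | (rw [abs_le]; constructor <;> nlinarith)
        | positivity
  · rcases pivotOf_eq_or x i q with h | h <;> rw [h] <;> fin_cases i <;>
      simp [mv, ex, medialPoint_mk, meshPoint_im, Pi.add_apply] <;>
      first
        | (rw [abs_le]; constructor <;> nlinarith)
        | positivity

/-- `0 < κ ≤ 1` (`cos (π/12) ≥ cos (π/3) = 1/2`). -/
theorem kappa_pos_le : 0 < kappa ∧ kappa ≤ 1 := by
  have hcos : (1:ℝ) / 2 ≤ Real.cos (Real.pi / 12) := by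
    rw [← Real.cos_pi_div_three]
    exact Real.cos_le_cos_of_nonneg_of_le_pi (by positivity) (by linarith [Real.pi_pos])
      (by linarith [Real.pi_pos])
  have h2 : (1:ℝ) ≤ 2 * Real.cos (Real.pi / 12) := by linarith
  exact ⟨inv_pos.2 (by linarith), inv_le_one_of_one_le₀ h2⟩

/-- `‖(κ : ℂ)‖ ≤ 1`. -/
theorem norm_kappa_le : ‖(kappa : ℂ)‖ ≤ 1 := by
  rw [Complex.norm_real, Real.norm_of_nonneg kappa_pos_le.1.le]
  exact kappa_pos_le.2

/-- The Green-gradient weights are nonnegative. -/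
theorem greenWeight_nonneg (Λ : Finset (Site 2)) (x₀ : Site 2) (q : Fin 4) (p : Site 2 × Fin 2) :
    0 ≤ greenWeight Λ x₀ q p := add_nonneg (abs_nonneg _) (abs_nonneg _)

/-- The difference weights are nonnegative. -/
theorem greenWeight₂_nonneg (Λ : Finset (Site 2)) (x₀ x₁ : Site 2) (q : Fin 4)
    (p : Site 2 × Fin 2) : 0 ≤ greenWeight₂ Λ x₀ x₁ q p := add_nonneg (abs_nonneg _) (abs_nonneg _)


/-! ### The composition: the five mathematical stubs give the repaired crux `C′` BY NAME

`ParafermionPrecompactRepairedAt_of` is sorry-free glue: an inner radius for `K`, the eventualities, the dart dictionary,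
Green's majorant on the deep sites fed by the vertex relation, the pointwise defect law and the
profile laws, the triangle inequality over the four classes. Every piece of mathematics is in a
stub; the glue only moves constants and finite sums. -/

/-- **The line.** Dart dictionary + exact vertex relation + Green majorant + sum-relation defect
rate + touch-profile laws imply the repaired crux
`∀ D Λ, Negative.ParafermionPrecompactRepairedAt D Λ` (both clauses). -/
theorem ParafermionPrecompactRepairedAt_of (h1 : Sig.stub_dartDictionary) (hV : Sig.stub_vertexRelation)
    (hP : Sig.stub_greenMajorant) (hZ : Sig.stub_sumRelationDefect)
    (hT : Sig.stub_touchProfileLaws) :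
    ∀ (D : DobrushinDomain) (Λ : ℝ → DiscreteDobrushin), ParafermionPrecompactRepairedAt D Λ := by
  intro D Λ hfam K hK hKD
  have hΩ : ∀ δ, (Λ δ).Ω = D.carrier := hfam.1
  have hδΛ : ∀ δ, (Λ δ).δ = δ := hfam.2.1
  have hadm : ∀ᶠ δ in 𝓝[>] (0:ℝ), (Λ δ).IsZdAdmissible := hfam.2.2.2.2.2
  obtain ⟨C_Z, pz, hpz, hCZ, hZ'⟩ := hZ
  -- a uniform inner radius for `K` (interiority of `K` is load-bearing)
  obtain ⟨r, hr, hrK⟩ := hK.exists_cthickening_subset_open D.isOpen hKD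
  have hK₁ : IsCompact (Metric.cthickening (r / 2) K) := hK.cthickening
  have hK₁D : Metric.cthickening (r / 2) K ⊆ D.carrier :=
    (Metric.cthickening_mono (by linarith) K).trans hrK
  obtain ⟨⟨C_T, hTev⟩, hTii⟩ := hT D Λ hfam _ hK₁ hK₁D pz hpz
  have hS1 := h1.1 D Λ hfam K hK hKD
  have hpos : ∀ᶠ δ in 𝓝[>] (0:ℝ), 0 < δ := eventually_mem_nhdsWithin
  have hlt : ∀ᶠ δ in 𝓝[>] (0:ℝ), δ < r / 20 :=
    (eventually_lt_nhds (by positivity)).filter_mono nhdsWithin_le_nhds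
  -- pivots of corners at a medial vertex over `K` are deep sites over `K₁`
  have geo : ∀ δ : ℝ, 0 < δ → δ < r / 20 → ∀ (x : Site 2) (i : Fin 2),
      medialPoint δ (mv (x, i)) ∈ K → ∀ q : Fin 4,
        pivotOf x i q ∈ deepSites D δ ∧
          meshPoint δ (pivotOf x i q) ∈ Metric.cthickening (r / 2) K := by
    intro δ hδ hδr x i hz q
    have hd := dist_pivotOf_le hδ.le x i q
    refine ⟨(mem_deepSites D hδ).2 ?_,
      Metric.mem_cthickening_of_dist_le _ _ _ _ hz (by linarith)⟩
    intro y hy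
    apply hrK
    refine Metric.mem_cthickening_of_dist_le y (medialPoint δ (mv (x, i))) r K hz ?_
    calc dist y (medialPoint δ (mv (x, i)))
        ≤ dist y (meshPoint δ (pivotOf x i q)) +
            dist (meshPoint δ (pivotOf x i q)) (medialPoint δ (mv (x, i))) := dist_triangle _ _ _
      _ ≤ 6 * δ + δ := add_le_add (Metric.mem_closedBall.1 hy) hd
      _ ≤ r := by linarith
  -- the exact vertex relation holds on the edges near the deep sites
  have vres : ∀ δ : ℝ, 0 < δ → (Λ δ).IsZdAdmissible →
      ∀ p ∈ nearEdges (deepSites D δ), vRes (dartField (Λ δ)) p = 0 := by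
    intro δ hδ hadmδ p hp
    obtain ⟨x', hx', hpw⟩ := Finset.mem_biUnion.1 hp
    obtain ⟨h0, h0'⟩ := abs_le_of_mem_window hpw
    have hball := (mem_deepSites D hδ).1 hx'
    apply hV (Λ δ) hadmδ p
    rw [hδΛ, hΩ]
    intro y hy
    apply hball
    rw [Metric.mem_closedBall] at hy ⊢
    have hmid := dist_medialPoint_mv_le hδ.le h0 h0'
    calc dist y (meshPoint δ x')
        ≤ dist y (medialPoint δ (mv p)) + dist (medialPoint δ (mv p)) (meshPoint δ x') :=
          dist_triangle _ _ _
      _ ≤ 2 * δ + 4 * δ := add_le_add hy hmid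
      _ = 6 * δ := by ring
  -- boundary values of a class component are touch probabilities at scale `δ`
  have hbdry : ∀ δ : ℝ, 0 < δ → ∀ (q : Fin 4) (w : Site 2),
      ‖classComp (dartField (Λ δ)) q w‖ ≤ touchProb (Λ δ) (meshPoint δ w) δ := by
    intro δ hδ q w
    have := h1.2 (Λ δ) (by rw [hδΛ]; exact hδ) q w
    rwa [hδΛ] at this
  refine ⟨?_, ?_⟩
  · -- clause (i): the bound `C δ^{1/3}` on genuine medial vertices over `K`
    refine ⟨4 * (C_Z * C_T + C_T), ?_⟩
    filter_upwards [hS1, hTev, hadm, hpos, hlt] with δ hS1δ hTδ hadmδ hδ hδr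
    intro z hz hzK
    obtain ⟨x, i, rfl⟩ := exists_eq_mk_add_single hz
    change medialPoint δ (mv (x, i)) ∈ K at hzK
    change ‖F Λ δ (mv (x, i))‖ ≤ _
    have hq : ∀ q : Fin 4,
        ‖classComp (dartField (Λ δ)) q (pivotOf x i q)‖ ≤ (C_Z * C_T + C_T) * δ ^ ((1:ℝ) / 3) := by
      intro q
      obtain ⟨hx₀, hx₀K⟩ := geo δ hδ hδr x i hzK q
      obtain ⟨hP1, -⟩ := hP (deepSites D δ) (dartField (Λ δ)) (vres δ hδ hadmδ) q _ hx₀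
      obtain ⟨hT1, hT2⟩ := hTδ q _ hx₀ hx₀K
      have hsum1 :
          (∑ p ∈ nearEdges (deepSites D δ),
              greenWeight (deepSites D δ) (pivotOf x i q) q p * ‖sRes (dartField (Λ δ)) p‖) ≤
            C_Z * ∑ p ∈ nearEdges (deepSites D δ),
              greenWeight (deepSites D δ) (pivotOf x i q) q p * defectProfile (Λ δ) pz p := by
        rw [Finset.mul_sum]
        refine Finset.sum_le_sum fun p _ => ?_
        calc greenWeight (deepSites D δ) (pivotOf x i q) q p * ‖sRes (dartField (Λ δ)) p‖
            ≤ greenWeight (deepSites D δ) (pivotOf x i q) q p * (C_Z * defectProfile (Λ δ) pz p) :=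
              mul_le_mul_of_nonneg_left (hZ' (Λ δ) hadmδ p) (greenWeight_nonneg _ _ _ _)
          _ = C_Z * (greenWeight (deepSites D δ) (pivotOf x i q) q p * defectProfile (Λ δ) pz p) := by
              ring
      have hsum2 :
          (∑ w ∈ outerBoundary (zdGraph 2) (deepSites D δ),
              Literature.Probability.LatticeModels.poissonKernel (deepSites D δ) (pivotOf x i q) w *
                ‖classComp (dartField (Λ δ)) q w‖) ≤
            ∑ w ∈ outerBoundary (zdGraph 2) (deepSites D δ),
              Literature.Probability.LatticeModels.poissonKernel (deepSites D δ) (pivotOf x i q) w *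
                touchProb (Λ δ) (meshPoint δ w) δ :=
        Finset.sum_le_sum fun w _ =>
          mul_le_mul_of_nonneg_left (hbdry δ hδ q w)
            (Literature.Probability.LatticeModels.poissonKernel_nonneg (by norm_num) _ _ _)
      calc ‖classComp (dartField (Λ δ)) q (pivotOf x i q)‖ ≤ _ := hP1
        _ ≤ C_Z * (C_T * δ ^ ((1:ℝ) / 3)) + C_T * δ ^ ((1:ℝ) / 3) :=
            add_le_add (hsum1.trans (mul_le_mul_of_nonneg_left hT1 hCZ)) (hsum2.trans hT2)
        _ = (C_Z * C_T + C_T) * δ ^ ((1:ℝ) / 3) := by ring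
    rw [hS1δ x i hzK, norm_mul]
    calc ‖(kappa : ℂ)‖ * ‖∑ q : Fin 4, classComp (dartField (Λ δ)) q (pivotOf x i q)‖
        ≤ 1 * ∑ q : Fin 4, ‖classComp (dartField (Λ δ)) q (pivotOf x i q)‖ :=
          mul_le_mul norm_kappa_le (norm_sum_le _ _) (norm_nonneg _) zero_le_one
      _ ≤ 1 * ∑ _q : Fin 4, (C_Z * C_T + C_T) * δ ^ ((1:ℝ) / 3) :=
          mul_le_mul_of_nonneg_left (Finset.sum_le_sum fun q _ => hq q) zero_le_one
      _ = 4 * (C_Z * C_T + C_T) * δ ^ ((1:ℝ) / 3) := by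
          simp only [Finset.sum_const, Finset.card_univ, Fintype.card_fin, nsmul_eq_mul]
          push_cast
          ring
  · -- clause (ii): asymptotic equicontinuity at scale `δ^{1/3}`
    intro ε hε
    set ε₁ : ℝ := ε / (4 * (C_Z + 1)) with hε₁def
    have hε₁ : 0 < ε₁ := by positivity
    obtain ⟨η₁, hη₁, hTev₂⟩ := hTii ε₁ hε₁
    refine ⟨η₁ / 2, by positivity, ?_⟩
    have hlt' : ∀ᶠ δ in 𝓝[>] (0:ℝ), δ < η₁ / 4 :=
      (eventually_lt_nhds (by positivity)).filter_mono nhdsWithin_le_nhds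
    filter_upwards [hS1, hTev₂, hadm, hpos, hlt, hlt'] with δ hS1δ hTδ hadmδ hδ hδr hδη
    intro z z' hz hz' hzK hz'K hdist
    obtain ⟨x, i, rfl⟩ := exists_eq_mk_add_single hz
    obtain ⟨x', i', rfl⟩ := exists_eq_mk_add_single hz'
    change medialPoint δ (mv (x, i)) ∈ K at hzK
    change medialPoint δ (mv (x', i')) ∈ K at hz'K
    change dist (medialPoint δ (mv (x, i))) (medialPoint δ (mv (x', i'))) < η₁ / 2 at hdist
    change ‖F Λ δ (mv (x, i)) - F Λ δ (mv (x', i'))‖ ≤ _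
    have hq : ∀ q : Fin 4,
        ‖classComp (dartField (Λ δ)) q (pivotOf x i q) -
            classComp (dartField (Λ δ)) q (pivotOf x' i' q)‖ ≤ (C_Z + 1) * ε₁ * δ ^ ((1:ℝ) / 3) := by
      intro q
      obtain ⟨hx₀, hx₀K⟩ := geo δ hδ hδr x i hzK q
      obtain ⟨hx₁, hx₁K⟩ := geo δ hδ hδr x' i' hz'K q
      have hd : dist (meshPoint δ (pivotOf x i q)) (meshPoint δ (pivotOf x' i' q)) < η₁ := by
        have e1 := dist_pivotOf_le hδ.le x i q
        have e2 := dist_pivotOf_le hδ.le x' i' q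
        rw [dist_comm] at e2
        calc dist (meshPoint δ (pivotOf x i q)) (meshPoint δ (pivotOf x' i' q))
            ≤ dist (meshPoint δ (pivotOf x i q)) (medialPoint δ (mv (x, i))) +
                dist (medialPoint δ (mv (x, i))) (medialPoint δ (mv (x', i'))) +
                dist (medialPoint δ (mv (x', i'))) (meshPoint δ (pivotOf x' i' q)) :=
              dist_triangle4 _ _ _ _
          _ < δ + η₁ / 2 + δ := by linarith
          _ ≤ η₁ := by linarith
      obtain ⟨-, hP2⟩ := hP (deepSites D δ) (dartField (Λ δ)) (vres δ hδ hadmδ) q _ hx₀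
      have hP2' := hP2 _ hx₁
      obtain ⟨hT1, hT2⟩ := hTδ q _ hx₀ _ hx₁ hx₀K hx₁K hd
      have hsum1 :
          (∑ p ∈ nearEdges (deepSites D δ),
              greenWeight₂ (deepSites D δ) (pivotOf x i q) (pivotOf x' i' q) q p *
                ‖sRes (dartField (Λ δ)) p‖) ≤
            C_Z * ∑ p ∈ nearEdges (deepSites D δ),
              greenWeight₂ (deepSites D δ) (pivotOf x i q) (pivotOf x' i' q) q p *
                defectProfile (Λ δ) pz p := by
        rw [Finset.mul_sum]
        refine Finset.sum_le_sum fun p _ => ?_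
        calc greenWeight₂ (deepSites D δ) (pivotOf x i q) (pivotOf x' i' q) q p *
              ‖sRes (dartField (Λ δ)) p‖
            ≤ greenWeight₂ (deepSites D δ) (pivotOf x i q) (pivotOf x' i' q) q p *
                (C_Z * defectProfile (Λ δ) pz p) :=
              mul_le_mul_of_nonneg_left (hZ' (Λ δ) hadmδ p) (greenWeight₂_nonneg _ _ _ _ _)
          _ = C_Z * (greenWeight₂ (deepSites D δ) (pivotOf x i q) (pivotOf x' i' q) q p *
                defectProfile (Λ δ) pz p) := by ring
      have hsum2 :
          (∑ w ∈ outerBoundary (zdGraph 2) (deepSites D δ),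
              |Literature.Probability.LatticeModels.poissonKernel (deepSites D δ) (pivotOf x i q) w -
                  Literature.Probability.LatticeModels.poissonKernel (deepSites D δ) (pivotOf x' i' q) w| *
                ‖classComp (dartField (Λ δ)) q w‖) ≤
            ∑ w ∈ outerBoundary (zdGraph 2) (deepSites D δ),
              |Literature.Probability.LatticeModels.poissonKernel (deepSites D δ) (pivotOf x i q) w -
                  Literature.Probability.LatticeModels.poissonKernel (deepSites D δ) (pivotOf x' i' q) w| *
                touchProb (Λ δ) (meshPoint δ w) δ :=
        Finset.sum_le_sum fun w _ => mul_le_mul_of_nonneg_left (hbdry δ hδ q w) (abs_nonneg _)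
      calc ‖classComp (dartField (Λ δ)) q (pivotOf x i q) -
              classComp (dartField (Λ δ)) q (pivotOf x' i' q)‖ ≤ _ := hP2'
        _ ≤ C_Z * (ε₁ * δ ^ ((1:ℝ) / 3)) + ε₁ * δ ^ ((1:ℝ) / 3) :=
            add_le_add (hsum1.trans (mul_le_mul_of_nonneg_left hT1 hCZ)) (hsum2.trans hT2)
        _ = (C_Z + 1) * ε₁ * δ ^ ((1:ℝ) / 3) := by ring
    rw [hS1δ x i hzK, hS1δ x' i' hz'K, ← mul_sub, ← Finset.sum_sub_distrib, norm_mul]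
    calc ‖(kappa : ℂ)‖ * ‖∑ q : Fin 4, (classComp (dartField (Λ δ)) q (pivotOf x i q) -
              classComp (dartField (Λ δ)) q (pivotOf x' i' q))‖
        ≤ 1 * ∑ q : Fin 4, ‖classComp (dartField (Λ δ)) q (pivotOf x i q) -
              classComp (dartField (Λ δ)) q (pivotOf x' i' q)‖ :=
          mul_le_mul norm_kappa_le (norm_sum_le _ _) (norm_nonneg _) zero_le_one
      _ ≤ 1 * ∑ _q : Fin 4, (C_Z + 1) * ε₁ * δ ^ ((1:ℝ) / 3) :=
          mul_le_mul_of_nonneg_left (Finset.sum_le_sum fun q _ => hq q) zero_le_one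
      _ = ε * δ ^ ((1:ℝ) / 3) := by
          simp only [Finset.sum_const, Finset.card_univ, Fintype.card_fin, nsmul_eq_mul]
          rw [hε₁def]
          have hC1 : (C_Z + 1) ≠ 0 := by positivity
          field_simp
          ring

/-- **The skeleton in its audited shape** (crux decl = the landed repaired statement
`Negative.ParafermionPrecompactRepairedAt`, registered with
`ledger skeleton check … --crux-decl …Negative.ParafermionPrecompactRepairedAt`, as the sibling line
`four-class-vertex-transfer`): the repaired crux with the five registered stubs plugged in. Depends
on `sorryAx` only through the `stub_*`; becomes the proof of C′ when the last stub is discharged. -/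
theorem repairedCrux_proof :
    ∀ (D : DobrushinDomain) (Λ : ℝ → DiscreteDobrushin), ParafermionPrecompactRepairedAt D Λ :=
  ParafermionPrecompactRepairedAt_of stub_dartDictionary stub_vertexRelation stub_greenMajorant
    stub_sumRelationDefect stub_touchProfileLaws

/-- The guarded (unfolded) text from the five stubs — the retarget if the restatement lands
unfolded: `theorem ParafermionPrecompact_of := ParafermionPrecompactGuarded_of`. -/
theorem ParafermionPrecompactGuarded_of :
    Sig.stub_dartDictionary → Sig.stub_vertexRelation → Sig.stub_greenMajorant →
      Sig.stub_sumRelationDefect → Sig.stub_touchProfileLaws → ParafermionPrecompactGuarded :=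
  fun h1 hV hP hZ hT => guarded_of_repairedAt (ParafermionPrecompactRepairedAt_of h1 hV hP hZ hT)

/-- **The route decl BY NAME, modulo the restatement gap.** Sorry-free; its first hypothesis
`RestatementGap` is NOT a registered obligation (see its docstring), so the default
`ledger skeleton check` (crux decl = the rev-5 route decl) reports exactly
`skeleton.extra-hypothesis (hgap : RestatementGap)` — the honest status of every line on this crux
until item 11293 is restated; after the restatement delete `hgap` (it is `id` up to unbundling). -/
theorem ParafermionPrecompact_of (hgap : RestatementGap) :
    Sig.stub_dartDictionary → Sig.stub_vertexRelation → Sig.stub_greenMajorant →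
      Sig.stub_sumRelationDefect → Sig.stub_touchProfileLaws → ParafermionPrecompact :=
  fun h1 hV hP hZ hT => hgap (ParafermionPrecompactRepairedAt_of h1 hV hP hZ hT)

end Summit.CriticalPhenomena.CardyFormulaZ2.Cruxes.ParafermionPrecompact.KenyonStreamSecondRelation

end
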